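import Summits.QuantumFields.YangMills.Theorems.UnitScaleTiltProp7FibreLevelMassT3
import HarnessLib

/-!
# Route `UnitScaleTilt`, crux K1 «MinimiserStabilityRegPr» (stmt-QuantumFields-19200), route-R [RP] curved — THE CURVED LINEAR CORE ON THE NONLINEAR (0.4)-FIBRE
# WITH `Z_Q` ELIMINATED: `((1∕4)ℓ⁻² − (18 + 537600L⁴)δ)·Σ‖Y‖² − (18 + 537600L⁴)·Z ≤ (18 + 537600L⁴)·Σ‖curl_{U₀}Y‖²_HS` for `Y = WU₀* − 1`, `W̄^{(K−n)} = Ū₀^{(K−n)}`,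
# under `10¹⁴L⁹ε ≤ 1` and the per-level two-block sups `μ_j` in their (B6) shape (`7800·L³·ℓ·μ_j ≤ θ·Lʲ`, `10⁹L⁴θ² ≤ 1`) — k- and volume-UNIFORM; and the (ii′) currency

Cell `ym3-torus`, D-0154 (3c) twin-width seat `ym-routeR-w3` (gen 2); sequel of ✓ p622368 `…CurvedLandauCoreFinalT3` (generic-`Y` core with a `Z_Q` budget hypothesis) and
✓ `…FibreLevelMassT3` (the `Z_Q` budget on the fibre from the sups alone).  THEOREMS ONLY (0 `def`, 0 `sorry`); `--supports stmt-QuantumFields-19200`, count-neutral.  YM₃ on T³ is a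
ladder rung (R3), not the Clay problem; nothing here claims the stub, the crux, d = 4 or the mass gap.

THE POINT.  ✓ p622368's fibre core `sum_normSq_le_curl_sq_core_of_fibre_T3'` displayed `Z_Q` explicitly in sup × mass data; its residual (B7) — the `ℓ²` masses of the nonlinear
level ratios — is now a theorem (✓ `Prop7FibreLevelMassT3.sum_normSq_trueLinIter_le_explicit_T3`: `Z_Q ≤ 24ℓ(200L⁴(CURL+DIV) + 4·10⁹L⁹εℓ⁻²Σ‖Y‖²) + 10⁶L⁴θ²ℓ⁻¹Σ‖Y‖²`), so
`96ℓ⁻¹Z_Q = 460800L⁴(CURL+DIV) + (9.216·10¹²L⁹ε + 9.6·10⁷L⁴θ²)·ℓ⁻²Σ‖Y‖²`: the first joins the right-hand side (CURL) and the divergence budget (DIV ≤ δΣ‖Y‖² + Z), the second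
is at most `0.19·ℓ⁻²Σ‖Y‖²` under `10¹⁴L⁹ε ≤ 1`, `10⁹L⁴θ² ≤ 1` — absorbed by the core's `½ℓ⁻²Σ‖Y‖²` with `¼` to spare.  The generic-`Y` core ✓ `sum_normSq_le_curl_sq_core_T3` is
applied at `Y := pertVar U₀ W` with `hQ :=` the (B7) theorem; §1 is the scalar absorption in a small context, §2 the knit, §3 the (ii′) relative-plaquette currency (✓ p605008).

WHAT IS PROVED (ns `…Theorems.Prop7CurvedLandauCoreFibreMassT3`).
* §1 `absorb` — the scalar absorption (pure reals).
* §2 ★★★ `sum_normSq_le_curl_sq_core_of_fibre_noZQ_T3` — the title.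
* §3 ★★★ `relPoincare_core_of_fibre_noZQ_T3` — the same with relative plaquettes on the right (`‖WU₀* − 1‖ ≤ s ≤ 1` bondwise).
DISPLAYED (honest, named suppliers): the (14)-type plaquette bound of `U₀` with `10¹⁴L⁹ε ≤ 1` (route standard, strengthened numeral); the fibre identity; the recursion families
(zero content, `exists_*`); the divergence budget `(δ, Z)` (the (Λ) Landau representative of RULING №25 reads it at `δ = Z = 0`, ✓ `divB_optimalRepr_eq`); the per-level two-block
sups `μ_j` with `72μ_j ≤ 1`, `3μ_j + 1∕24 < δ₂` and the (B6) shape `7800·L³·ℓ·μ_j ≤ θ·Lʲ`, `10⁹L⁴θ² ≤ 1` — supplied by ★routeR-w1 g2's ✓ p624016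
`Prop7FibreLevelSupLocalGauge.twoBlockMass_le_of_plaqBound` as `μ_j = 4d(d+1)(d+2)L^{d+1}·Lʲ·ρ_W` (`θ = 1 872 000·L⁷·ℓρ_W`).  NO `ℓ²`-mass input, NO structure row, NO `Z_Q`.

References: T. Bałaban, CMP 99 (1985) 389–434 [Balaban1985BackgroundPropagators] (Thm 3.11 p.416); CMP 102 (1985) 277–309 [Balaban1985Variational] ((14)–(15) p.280,
(141)–(143) p.299, Prop. 7 p.299); CMP 98 (1985) 17–51 [Balaban1985Averaging] (Prop. 3 (122)–(126) p.36); CMP 95 (1984) 17–40 [Balaban1984PropagatorsI] ((1.18)–(1.20) pp.19–20).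
-/

set_option autoImplicit false

noncomputable section

open scoped BigOperators Matrix.Norms.L2Operator Matrix

namespace Summit.QuantumFields.YangMills.Theorems.Prop7CurvedLandauCoreFibreMassT3

open Literature.MathematicalPhysics.QuantumFieldTheory.Balaban1983to89
open Literature.MathematicalPhysics.QuantumFieldTheory.Balaban1983to89.T3ContinuumYM3Torus
open Finset T4Continuum T4ReflectionCone BlockAveraging AveragingRT ExpMeanLog BlockAveragingEMLLinearised BlockAveragingEMLLinearisedBackground
  BlockAveragingEMLProp2 B1RG242Torus
open B9Eq39Adjoint (curl divB)
open B10Eq27TorusAxialLog (holT unitsField toUField)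
open B9TorusCalculus (torusT)
open Summit.QuantumFields.YangMills.Theorems.Prop7CurvedLandauKnitT3 (three_le_L)
open Summit.QuantumFields.YangMills.Theorems.Prop7CurvedLandauCoreFinalT3 (sum_normSq_le_curl_sq_core_T3)
open Summit.QuantumFields.YangMills.Theorems.Prop7RelPlaqVsCovCurl (sum_hs_curl_le_relPlaq_T3)
open Summit.QuantumFields.YangMills.Theorems.Prop7FibreLevelMassT3 (sum_normSq_trueLinIter_le_explicit_T3)

/-! ## §1 The scalar absorption -/

/-- THE SCALAR ABSORPTION (pure reals): the generic core row with the (B7) value of `Z_Q` substituted, the divergence budget, `10¹⁴L⁹ε ≤ 1` and `10⁹L⁴θ² ≤ 1` give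
`((1∕4)ℓ⁻² − (18 + 537600L⁴)δ)M − (18 + 537600L⁴)Z ≤ (18 + 537600L⁴)·CURL`. [folklore] -/
theorem absorb {ℓ L ε θ δ Z M C D : ℝ} (hℓ : 0 < ℓ) (hM : 0 ≤ M)
    (hεL : 100000000000000 * L ^ 9 * ε ≤ 1) (hθ : 1000000000 * L ^ 4 * θ ^ 2 ≤ 1)
    (hdiv : D ≤ δ * M + Z)
    (hcore : ((1 / 2) * (ℓ ^ 2)⁻¹ - (18 + 76800 * L ^ 4) * δ) * M - (18 + 76800 * L ^ 4) * Z
        - 96 * ℓ⁻¹ * (24 * ℓ * (200 * L ^ 4 * (C + D) + 4 * 10 ^ 9 * L ^ 9 * ε * (ℓ ^ 2)⁻¹ * M) + 1000000 * L ^ 4 * θ ^ 2 * ℓ⁻¹ * M)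
      ≤ (18 + 76800 * L ^ 4) * C) :
    ((1 / 4) * (ℓ ^ 2)⁻¹ - (18 + 537600 * L ^ 4) * δ) * M - (18 + 537600 * L ^ 4) * Z ≤ (18 + 537600 * L ^ 4) * C := by
  have hℓne : ℓ ≠ 0 := hℓ.ne'
  have hX0 : 0 ≤ (ℓ ^ 2)⁻¹ * M := by positivity
  have hL4 : 0 ≤ 460800 * L ^ 4 := by positivity
  have e3 : 96 * ℓ⁻¹ * (24 * ℓ * (200 * L ^ 4 * (C + D) + 4 * 10 ^ 9 * L ^ 9 * ε * (ℓ ^ 2)⁻¹ * M) + 1000000 * L ^ 4 * θ ^ 2 * ℓ⁻¹ * M)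
      = 460800 * L ^ 4 * (C + D) + 9216000000000 * L ^ 9 * ε * ((ℓ ^ 2)⁻¹ * M) + 96000000 * L ^ 4 * θ ^ 2 * ((ℓ ^ 2)⁻¹ * M) := by
    field_simp
    ring
  rw [e3] at hcore
  have hdivL := mul_le_mul_of_nonneg_left hdiv hL4
  have hεX := mul_le_mul_of_nonneg_right hεL hX0
  have hθX := mul_le_mul_of_nonneg_right hθ hX0
  nlinarith [hcore, hdivL, hεX, hθX, hX0]

/-! ## §2 ★★★ The fibre core with `Z_Q` eliminated -/

set_option maxHeartbeats 400000 in
/-- ★★★ **THE CURVED LINEAR CORE ON THE NONLINEAR (0.4)-FIBRE, `Z_Q` ELIMINATED (d = 3, `SU(2)`).**  `U₀, W` on the finest torus of run `K`, `W̄^{(K−n)} = Ū₀^{(K−n)}`;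
`dist1(U₀(∂p)) ≤ εℓ⁻²` (`ℓ = L^{K−n}`, `0 < ε`, `10¹⁴L⁹ε ≤ 1`); `Y := pertVar U₀ W`; `Q, G, S, Λ` the recursion families of record at `Y` (displayed, zero content); the divergence
budget `Σ‖D^*_{U₀}Y‖²_HS ≤ δΣ‖Y‖² + Z`; per-level bounds `μ_j` of the two-block masses of the level ratios (`0 ≤ μ_j`, `72μ_j ≤ 1`, `3μ_j + 1∕24 < δ₂`) in the (B6) shape
`7800·L³·ℓ·μ_j ≤ θ·Lʲ` with `0 ≤ θ`, `10⁹L⁴θ² ≤ 1`.  THEN  `((1∕4)ℓ⁻² − (18 + 537600L⁴)δ)·Σ‖Y‖² − (18 + 537600L⁴)·Z ≤ (18 + 537600L⁴)·Σ‖curl_{U₀}Y‖²_HS`.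
[cite: Balaban1985BackgroundPropagators, Thm 3.11 p.416; Balaban1985Variational, (14)-(15) p.280, Prop. 7 p.299; Balaban1985Averaging, Prop. 3 (122)-(126) p.36] -/
theorem sum_normSq_le_curl_sq_core_of_fibre_noZQ_T3 (F : T3Family) (n K : ℕ)
    (U₀ W : GaugeField (F.P K) 0 (Matrix.specialUnitaryGroup (Fin 2) ℂ)) {ε : ℝ} (hε : 0 < ε) (hεL : 100000000000000 * (F.L : ℝ) ^ 9 * ε ≤ 1)
    (hU : ∀ p : Plaq (F.P K) 0, dist1 (GaugeField.plaqHol U₀ p) ≤ ε * (((F.L : ℝ) ^ (K - n)) ^ 2)⁻¹)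
    (hfib : Averaging.iter (fun i => blockAvg (P := (F.P K)) (j := i) (expMeanLogSU (n := Fin 2))) (K - n) W = Averaging.iter (fun i => blockAvg (P := (F.P K)) (j := i) (expMeanLogSU (n := Fin 2))) (K - n) U₀)
    (Q : (k : ℕ) → (PBond (F.P K) 0 → Matrix (Fin 2) (Fin 2) ℂ) → PBond (F.P K) k → Matrix (Fin 2) (Fin 2) ℂ) (hQ0 : ∀ Y, Q 0 Y = Y)
    (hQs : ∀ (k : ℕ) (Y : PBond (F.P K) 0 → Matrix (Fin 2) (Fin 2) ℂ) (c : PBond (F.P K) (k + 1)), Q (k + 1) Y c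
      = (fderiv ℂ (eml : (Idx (F.P K) → Matrix (Fin 2) (Fin 2) ℂ) → Matrix (Fin 2) (Fin 2) ℂ)
            (fun i => ((loopHol (Averaging.iter (fun i => blockAvg (P := (F.P K)) (j := i) (expMeanLogSU (n := Fin 2))) k U₀) c i : Matrix.specialUnitaryGroup (Fin 2) ℂ) : Matrix (Fin 2) (Fin 2) ℂ))
            (fun i => covWalkSum (Averaging.iter (fun i => blockAvg (P := (F.P K)) (j := i) (expMeanLogSU (n := Fin 2))) k U₀) (Q k Y) (walk (emb c.src) (loopWord (F.P K).L c.dir (off i.1) i.2.1 i.2.2))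
              * ((loopHol (Averaging.iter (fun i => blockAvg (P := (F.P K)) (j := i) (expMeanLogSU (n := Fin 2))) k U₀) c i : Matrix.specialUnitaryGroup (Fin 2) ℂ) : Matrix (Fin 2) (Fin 2) ℂ))
            * star ((corr (expMeanLogSU (n := Fin 2)) (Averaging.iter (fun i => blockAvg (P := (F.P K)) (j := i) (expMeanLogSU (n := Fin 2))) k U₀) c : Matrix.specialUnitaryGroup (Fin 2) ℂ) : Matrix (Fin 2) (Fin 2) ℂ)
          + ((corr (expMeanLogSU (n := Fin 2)) (Averaging.iter (fun i => blockAvg (P := (F.P K)) (j := i) (expMeanLogSU (n := Fin 2))) k U₀) c : Matrix.specialUnitaryGroup (Fin 2) ℂ) : Matrix (Fin 2) (Fin 2) ℂ)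
            * covWalkSum (Averaging.iter (fun i => blockAvg (P := (F.P K)) (j := i) (expMeanLogSU (n := Fin 2))) k U₀) (Q k Y) (walk (emb c.src) (List.replicate (F.P K).L (c.dir, true)))
            * star ((corr (expMeanLogSU (n := Fin 2)) (Averaging.iter (fun i => blockAvg (P := (F.P K)) (j := i) (expMeanLogSU (n := Fin 2))) k U₀) c : Matrix.specialUnitaryGroup (Fin 2) ℂ) : Matrix (Fin 2) (Fin 2) ℂ)))
    (G S : (k : ℕ) → PBond (F.P K) k → Matrix (Fin 2) (Fin 2) ℂ) (Λ : (k : ℕ) → Site (F.P K) k → Matrix (Fin 2) (Fin 2) ℂ)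
    (hG0 : ∀ b, G 0 b = pertVar U₀ W b) (hS0 : ∀ b, S 0 b = pertVar U₀ W b) (hΛ0 : ∀ x, Λ 0 x = 0)
    (hΛs : ∀ (k : ℕ) (z : Site (F.P K) (k + 1)), Λ (k + 1) z
      = (((Fintype.card (Idx (F.P K)) : ℂ))⁻¹ • ∑ i : Idx (F.P K),
              covWalkSum (Averaging.iter (fun i => blockAvg (P := (F.P K)) (j := i) (expMeanLogSU (n := Fin 2))) k U₀) (G k) (walk (emb z) (stairWord i.2.1 (off i.1))))
        + Λ k (emb z))
    (hGs : ∀ (k : ℕ) (c : PBond (F.P K) (k + 1)), G (k + 1) c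
      = (fderiv ℂ (eml : (Idx (F.P K) → Matrix (Fin 2) (Fin 2) ℂ) → Matrix (Fin 2) (Fin 2) ℂ)
            (fun i => ((loopHol (Averaging.iter (fun i => blockAvg (P := (F.P K)) (j := i) (expMeanLogSU (n := Fin 2))) k U₀) c i : Matrix.specialUnitaryGroup (Fin 2) ℂ) : Matrix (Fin 2) (Fin 2) ℂ))
            (fun i => covWalkSum (Averaging.iter (fun i => blockAvg (P := (F.P K)) (j := i) (expMeanLogSU (n := Fin 2))) k U₀) (G k) (walk (emb c.src) (loopWord (F.P K).L c.dir (off i.1) i.2.1 i.2.2))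
              * ((loopHol (Averaging.iter (fun i => blockAvg (P := (F.P K)) (j := i) (expMeanLogSU (n := Fin 2))) k U₀) c i : Matrix.specialUnitaryGroup (Fin 2) ℂ) : Matrix (Fin 2) (Fin 2) ℂ))
            * star ((corr (expMeanLogSU (n := Fin 2)) (Averaging.iter (fun i => blockAvg (P := (F.P K)) (j := i) (expMeanLogSU (n := Fin 2))) k U₀) c : Matrix.specialUnitaryGroup (Fin 2) ℂ) : Matrix (Fin 2) (Fin 2) ℂ)
          + ((corr (expMeanLogSU (n := Fin 2)) (Averaging.iter (fun i => blockAvg (P := (F.P K)) (j := i) (expMeanLogSU (n := Fin 2))) k U₀) c : Matrix.specialUnitaryGroup (Fin 2) ℂ) : Matrix (Fin 2) (Fin 2) ℂ)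
            * covWalkSum (Averaging.iter (fun i => blockAvg (P := (F.P K)) (j := i) (expMeanLogSU (n := Fin 2))) k U₀) (G k) (walk (emb c.src) (List.replicate (F.P K).L (c.dir, true)))
            * star ((corr (expMeanLogSU (n := Fin 2)) (Averaging.iter (fun i => blockAvg (P := (F.P K)) (j := i) (expMeanLogSU (n := Fin 2))) k U₀) c : Matrix.specialUnitaryGroup (Fin 2) ℂ) : Matrix (Fin 2) (Fin 2) ℂ))
        - ((((Fintype.card (Idx (F.P K)) : ℂ))⁻¹ • ∑ i : Idx (F.P K),
              covWalkSum (Averaging.iter (fun i => blockAvg (P := (F.P K)) (j := i) (expMeanLogSU (n := Fin 2))) k U₀) (G k) (walk (emb c.src) (stairWord i.2.1 (off i.1))))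
            - ((Averaging.iter (fun i => blockAvg (P := (F.P K)) (j := i) (expMeanLogSU (n := Fin 2))) (k + 1) U₀ c : Matrix.specialUnitaryGroup (Fin 2) ℂ) : Matrix (Fin 2) (Fin 2) ℂ)
              * (((Fintype.card (Idx (F.P K)) : ℂ))⁻¹ • ∑ i : Idx (F.P K),
              covWalkSum (Averaging.iter (fun i => blockAvg (P := (F.P K)) (j := i) (expMeanLogSU (n := Fin 2))) k U₀) (G k) (walk (emb c.tgt) (stairWord i.2.1 (off i.1))))
              * star ((Averaging.iter (fun i => blockAvg (P := (F.P K)) (j := i) (expMeanLogSU (n := Fin 2))) (k + 1) U₀ c : Matrix.specialUnitaryGroup (Fin 2) ℂ) : Matrix (Fin 2) (Fin 2) ℂ)))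
    (hSs : ∀ (k : ℕ) (c : PBond (F.P K) (k + 1)), S (k + 1) c
      = ((Fintype.card (Idx (F.P K)) : ℂ))⁻¹ • ∑ i : Idx (F.P K),
          ((holAt (Averaging.iter (fun i => blockAvg (P := (F.P K)) (j := i) (expMeanLogSU (n := Fin 2))) k U₀) (walk (emb c.src) (stairWord i.2.1 (off i.1))) : Matrix.specialUnitaryGroup (Fin 2) ℂ) : Matrix (Fin 2) (Fin 2) ℂ) *
            covWalkSum (Averaging.iter (fun i => blockAvg (P := (F.P K)) (j := i) (expMeanLogSU (n := Fin 2))) k U₀) (S k)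
              (walk (walkEnd (emb c.src) (stairWord i.2.1 (off i.1))) (List.replicate (F.P K).L (c.dir, true))) *
          star ((holAt (Averaging.iter (fun i => blockAvg (P := (F.P K)) (j := i) (expMeanLogSU (n := Fin 2))) k U₀) (walk (emb c.src) (stairWord i.2.1 (off i.1))) : Matrix.specialUnitaryGroup (Fin 2) ℂ) : Matrix (Fin 2) (Fin 2) ℂ))
    {δ Z : ℝ}
    (hdivB : (∑ x : Site (F.P K) 0, ∑ j : Fin 2, ∑ k : Fin 2,
            ‖(divB (torusT (F.P K) 0) (fun κ z => unitsField (toUField U₀) ⟨z, κ⟩) (fun κ z => pertVar U₀ W ⟨z, κ⟩) x) j k‖ ^ 2)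
      ≤ δ * (∑ b : PBond (F.P K) 0, ‖pertVar U₀ W b‖ ^ 2) + Z)
    (μ : ℕ → ℝ) (hμ0 : ∀ j < K - n, 0 ≤ μ j)
    (hμ : ∀ j < K - n, ∀ c : PBond (F.P K) (j + 1), ((((F.P K).d + 2) * (F.P K).L : ℕ) : ℝ) * ∑ b ∈ (univ.filter (fun b : PBond (F.P K) j => blockOf b.src = c.src ∨ blockOf b.src = c.tgt)), ‖(pertVar (Averaging.iter (fun i => blockAvg (P := (F.P K)) (j := i) (expMeanLogSU (n := Fin 2))) j U₀) (Averaging.iter (fun i => blockAvg (P := (F.P K)) (j := i) (expMeanLogSU (n := Fin 2))) j W)) b‖ ≤ μ j)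
    (hμ72 : ∀ j < K - n, 72 * μ j ≤ 1) (hμN : ∀ j < K - n, 3 * μ j + 1 / 24 < deltaSU (Fin 2))
    {θ : ℝ} (hθ0 : 0 ≤ θ) (hμθ : ∀ j < K - n, 7800 * (F.L : ℝ) ^ 3 * (F.L : ℝ) ^ (K - n) * μ j ≤ θ * (F.L : ℝ) ^ j)
    (hθ : 1000000000 * (F.L : ℝ) ^ 4 * θ ^ 2 ≤ 1) :
    ((1 / 4) * ((((F.L : ℝ) ^ (K - n))) ^ 2)⁻¹ - (18 + 537600 * (F.L : ℝ) ^ 4) * δ) * (∑ b : PBond (F.P K) 0, ‖pertVar U₀ W b‖ ^ 2) - (18 + 537600 * (F.L : ℝ) ^ 4) * Z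
      ≤ (18 + 537600 * (F.L : ℝ) ^ 4) * (∑ x : Site (F.P K) 0, ∑ μ : Fin (F.P K).d, ∑ ν : Fin (F.P K).d,
            (if μ < ν then ∑ j : Fin 2, ∑ k : Fin 2,
              ‖(curl (torusT (F.P K) 0) (fun κ z => unitsField (toUField U₀) ⟨z, κ⟩) (fun κ z => pertVar U₀ W ⟨z, κ⟩) μ ν x) j k‖ ^ 2 else 0)) := by
  have hL3 := three_le_L F
  have hL1 : (1 : ℝ) ≤ (F.L : ℝ) := by linarith only [hL3]
  have hL9 : 0 ≤ (F.L : ℝ) ^ 9 * ε := by positivity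
  have hεL13 : 20000000000000 * (F.L : ℝ) ^ 9 * ε ≤ 1 := by linarith only [hεL, hL9]
  have hεL6 : 1000000 * (F.L : ℝ) ^ 5 * ε ≤ 1 := by
    have h1 : (F.L : ℝ) ^ 5 ≤ (F.L : ℝ) ^ 9 := pow_le_pow_right₀ hL1 (by norm_num)
    nlinarith only [h1, hε.le, hεL]
  -- `1000·θ·L ≤ 1` from `10⁹L⁴θ² ≤ 1`
  have hθL : 1000 * θ * (F.L : ℝ) ≤ 1 := by
    have hsq : (1000 * θ * (F.L : ℝ)) ^ 2 ≤ 1 := by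
      have hL2 : (1 : ℝ) ≤ (F.L : ℝ) ^ 2 := one_le_pow₀ hL1
      have hθ2 : 0 ≤ θ ^ 2 * (F.L : ℝ) ^ 2 := by positivity
      nlinarith only [hθ, hL2, hθ2]
    exact (pow_le_one_iff_of_nonneg (by positivity) two_ne_zero).1 hsq
  -- the (B7) budget and the generic core at it
  have hQ := sum_normSq_trueLinIter_le_explicit_T3 F n K U₀ W hε hεL6 hU hfib Q hQ0 hQs G S Λ hG0 hS0 hΛ0 hΛs hGs hSs μ hμ0 hμ hμ72 hμN hθ0 hμθ hθL
  have hcore := sum_normSq_le_curl_sq_core_T3 F n K U₀ hε hεL13 hU Q hQ0 hQs (pertVar U₀ W) G S Λ hG0 hS0 hΛ0 hΛs hGs hSs hdivB hQ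
  exact absorb (pow_pos (by linarith only [hL3]) (K - n)) (Finset.sum_nonneg fun _ _ => sq_nonneg _) hεL hθ hdivB hcore

/-! ## §3 ★★★ The same in the (ii′) currency -/

set_option maxHeartbeats 400000 in
/-- ★★★ **THE SAME WITH RELATIVE PLAQUETTES ON THE RIGHT** (`‖WU₀* − 1‖ ≤ s ≤ 1` bondwise; ✓ p605008 `sum_hs_curl_le_relPlaq_T3`):
`((1∕4)ℓ⁻² − (18 + 537600L⁴)(δ + 24576s² + 768(εℓ⁻²)²))·Σ‖Y‖² − (18 + 537600L⁴)·Z ≤ (18 + 537600L⁴)·4·Σ_p‖W(∂p)U₀(∂p)* − 1‖²`.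
[cite: Balaban1985Variational, (141)-(143) p.299; Balaban1985BackgroundPropagators, Thm 3.11 p.416] -/
theorem relPoincare_core_of_fibre_noZQ_T3 (F : T3Family) (n K : ℕ)
    (U₀ W : GaugeField (F.P K) 0 (Matrix.specialUnitaryGroup (Fin 2) ℂ)) {ε : ℝ} (hε : 0 < ε) (hεL : 100000000000000 * (F.L : ℝ) ^ 9 * ε ≤ 1)
    (hU : ∀ p : Plaq (F.P K) 0, dist1 (GaugeField.plaqHol U₀ p) ≤ ε * (((F.L : ℝ) ^ (K - n)) ^ 2)⁻¹)
    (hfib : Averaging.iter (fun i => blockAvg (P := (F.P K)) (j := i) (expMeanLogSU (n := Fin 2))) (K - n) W = Averaging.iter (fun i => blockAvg (P := (F.P K)) (j := i) (expMeanLogSU (n := Fin 2))) (K - n) U₀)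
    (Q : (k : ℕ) → (PBond (F.P K) 0 → Matrix (Fin 2) (Fin 2) ℂ) → PBond (F.P K) k → Matrix (Fin 2) (Fin 2) ℂ) (hQ0 : ∀ Y, Q 0 Y = Y)
    (hQs : ∀ (k : ℕ) (Y : PBond (F.P K) 0 → Matrix (Fin 2) (Fin 2) ℂ) (c : PBond (F.P K) (k + 1)), Q (k + 1) Y c
      = (fderiv ℂ (eml : (Idx (F.P K) → Matrix (Fin 2) (Fin 2) ℂ) → Matrix (Fin 2) (Fin 2) ℂ)
            (fun i => ((loopHol (Averaging.iter (fun i => blockAvg (P := (F.P K)) (j := i) (expMeanLogSU (n := Fin 2))) k U₀) c i : Matrix.specialUnitaryGroup (Fin 2) ℂ) : Matrix (Fin 2) (Fin 2) ℂ))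
            (fun i => covWalkSum (Averaging.iter (fun i => blockAvg (P := (F.P K)) (j := i) (expMeanLogSU (n := Fin 2))) k U₀) (Q k Y) (walk (emb c.src) (loopWord (F.P K).L c.dir (off i.1) i.2.1 i.2.2))
              * ((loopHol (Averaging.iter (fun i => blockAvg (P := (F.P K)) (j := i) (expMeanLogSU (n := Fin 2))) k U₀) c i : Matrix.specialUnitaryGroup (Fin 2) ℂ) : Matrix (Fin 2) (Fin 2) ℂ))
            * star ((corr (expMeanLogSU (n := Fin 2)) (Averaging.iter (fun i => blockAvg (P := (F.P K)) (j := i) (expMeanLogSU (n := Fin 2))) k U₀) c : Matrix.specialUnitaryGroup (Fin 2) ℂ) : Matrix (Fin 2) (Fin 2) ℂ)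
          + ((corr (expMeanLogSU (n := Fin 2)) (Averaging.iter (fun i => blockAvg (P := (F.P K)) (j := i) (expMeanLogSU (n := Fin 2))) k U₀) c : Matrix.specialUnitaryGroup (Fin 2) ℂ) : Matrix (Fin 2) (Fin 2) ℂ)
            * covWalkSum (Averaging.iter (fun i => blockAvg (P := (F.P K)) (j := i) (expMeanLogSU (n := Fin 2))) k U₀) (Q k Y) (walk (emb c.src) (List.replicate (F.P K).L (c.dir, true)))
            * star ((corr (expMeanLogSU (n := Fin 2)) (Averaging.iter (fun i => blockAvg (P := (F.P K)) (j := i) (expMeanLogSU (n := Fin 2))) k U₀) c : Matrix.specialUnitaryGroup (Fin 2) ℂ) : Matrix (Fin 2) (Fin 2) ℂ)))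
    (G S : (k : ℕ) → PBond (F.P K) k → Matrix (Fin 2) (Fin 2) ℂ) (Λ : (k : ℕ) → Site (F.P K) k → Matrix (Fin 2) (Fin 2) ℂ)
    (hG0 : ∀ b, G 0 b = pertVar U₀ W b) (hS0 : ∀ b, S 0 b = pertVar U₀ W b) (hΛ0 : ∀ x, Λ 0 x = 0)
    (hΛs : ∀ (k : ℕ) (z : Site (F.P K) (k + 1)), Λ (k + 1) z
      = (((Fintype.card (Idx (F.P K)) : ℂ))⁻¹ • ∑ i : Idx (F.P K),
              covWalkSum (Averaging.iter (fun i => blockAvg (P := (F.P K)) (j := i) (expMeanLogSU (n := Fin 2))) k U₀) (G k) (walk (emb z) (stairWord i.2.1 (off i.1))))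
        + Λ k (emb z))
    (hGs : ∀ (k : ℕ) (c : PBond (F.P K) (k + 1)), G (k + 1) c
      = (fderiv ℂ (eml : (Idx (F.P K) → Matrix (Fin 2) (Fin 2) ℂ) → Matrix (Fin 2) (Fin 2) ℂ)
            (fun i => ((loopHol (Averaging.iter (fun i => blockAvg (P := (F.P K)) (j := i) (expMeanLogSU (n := Fin 2))) k U₀) c i : Matrix.specialUnitaryGroup (Fin 2) ℂ) : Matrix (Fin 2) (Fin 2) ℂ))
            (fun i => covWalkSum (Averaging.iter (fun i => blockAvg (P := (F.P K)) (j := i) (expMeanLogSU (n := Fin 2))) k U₀) (G k) (walk (emb c.src) (loopWord (F.P K).L c.dir (off i.1) i.2.1 i.2.2))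
              * ((loopHol (Averaging.iter (fun i => blockAvg (P := (F.P K)) (j := i) (expMeanLogSU (n := Fin 2))) k U₀) c i : Matrix.specialUnitaryGroup (Fin 2) ℂ) : Matrix (Fin 2) (Fin 2) ℂ))
            * star ((corr (expMeanLogSU (n := Fin 2)) (Averaging.iter (fun i => blockAvg (P := (F.P K)) (j := i) (expMeanLogSU (n := Fin 2))) k U₀) c : Matrix.specialUnitaryGroup (Fin 2) ℂ) : Matrix (Fin 2) (Fin 2) ℂ)
          + ((corr (expMeanLogSU (n := Fin 2)) (Averaging.iter (fun i => blockAvg (P := (F.P K)) (j := i) (expMeanLogSU (n := Fin 2))) k U₀) c : Matrix.specialUnitaryGroup (Fin 2) ℂ) : Matrix (Fin 2) (Fin 2) ℂ)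
            * covWalkSum (Averaging.iter (fun i => blockAvg (P := (F.P K)) (j := i) (expMeanLogSU (n := Fin 2))) k U₀) (G k) (walk (emb c.src) (List.replicate (F.P K).L (c.dir, true)))
            * star ((corr (expMeanLogSU (n := Fin 2)) (Averaging.iter (fun i => blockAvg (P := (F.P K)) (j := i) (expMeanLogSU (n := Fin 2))) k U₀) c : Matrix.specialUnitaryGroup (Fin 2) ℂ) : Matrix (Fin 2) (Fin 2) ℂ))
        - ((((Fintype.card (Idx (F.P K)) : ℂ))⁻¹ • ∑ i : Idx (F.P K),
              covWalkSum (Averaging.iter (fun i => blockAvg (P := (F.P K)) (j := i) (expMeanLogSU (n := Fin 2))) k U₀) (G k) (walk (emb c.src) (stairWord i.2.1 (off i.1))))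
            - ((Averaging.iter (fun i => blockAvg (P := (F.P K)) (j := i) (expMeanLogSU (n := Fin 2))) (k + 1) U₀ c : Matrix.specialUnitaryGroup (Fin 2) ℂ) : Matrix (Fin 2) (Fin 2) ℂ)
              * (((Fintype.card (Idx (F.P K)) : ℂ))⁻¹ • ∑ i : Idx (F.P K),
              covWalkSum (Averaging.iter (fun i => blockAvg (P := (F.P K)) (j := i) (expMeanLogSU (n := Fin 2))) k U₀) (G k) (walk (emb c.tgt) (stairWord i.2.1 (off i.1))))
              * star ((Averaging.iter (fun i => blockAvg (P := (F.P K)) (j := i) (expMeanLogSU (n := Fin 2))) (k + 1) U₀ c : Matrix.specialUnitaryGroup (Fin 2) ℂ) : Matrix (Fin 2) (Fin 2) ℂ)))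
    (hSs : ∀ (k : ℕ) (c : PBond (F.P K) (k + 1)), S (k + 1) c
      = ((Fintype.card (Idx (F.P K)) : ℂ))⁻¹ • ∑ i : Idx (F.P K),
          ((holAt (Averaging.iter (fun i => blockAvg (P := (F.P K)) (j := i) (expMeanLogSU (n := Fin 2))) k U₀) (walk (emb c.src) (stairWord i.2.1 (off i.1))) : Matrix.specialUnitaryGroup (Fin 2) ℂ) : Matrix (Fin 2) (Fin 2) ℂ) *
            covWalkSum (Averaging.iter (fun i => blockAvg (P := (F.P K)) (j := i) (expMeanLogSU (n := Fin 2))) k U₀) (S k)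
              (walk (walkEnd (emb c.src) (stairWord i.2.1 (off i.1))) (List.replicate (F.P K).L (c.dir, true))) *
          star ((holAt (Averaging.iter (fun i => blockAvg (P := (F.P K)) (j := i) (expMeanLogSU (n := Fin 2))) k U₀) (walk (emb c.src) (stairWord i.2.1 (off i.1))) : Matrix.specialUnitaryGroup (Fin 2) ℂ) : Matrix (Fin 2) (Fin 2) ℂ))
    {δ Z : ℝ}
    (hdivB : (∑ x : Site (F.P K) 0, ∑ j : Fin 2, ∑ k : Fin 2,
            ‖(divB (torusT (F.P K) 0) (fun κ z => unitsField (toUField U₀) ⟨z, κ⟩) (fun κ z => pertVar U₀ W ⟨z, κ⟩) x) j k‖ ^ 2)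
      ≤ δ * (∑ b : PBond (F.P K) 0, ‖pertVar U₀ W b‖ ^ 2) + Z)
    (μ : ℕ → ℝ) (hμ0 : ∀ j < K - n, 0 ≤ μ j)
    (hμ : ∀ j < K - n, ∀ c : PBond (F.P K) (j + 1), ((((F.P K).d + 2) * (F.P K).L : ℕ) : ℝ) * ∑ b ∈ (univ.filter (fun b : PBond (F.P K) j => blockOf b.src = c.src ∨ blockOf b.src = c.tgt)), ‖(pertVar (Averaging.iter (fun i => blockAvg (P := (F.P K)) (j := i) (expMeanLogSU (n := Fin 2))) j U₀) (Averaging.iter (fun i => blockAvg (P := (F.P K)) (j := i) (expMeanLogSU (n := Fin 2))) j W)) b‖ ≤ μ j)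
    (hμ72 : ∀ j < K - n, 72 * μ j ≤ 1) (hμN : ∀ j < K - n, 3 * μ j + 1 / 24 < deltaSU (Fin 2))
    {θ : ℝ} (hθ0 : 0 ≤ θ) (hμθ : ∀ j < K - n, 7800 * (F.L : ℝ) ^ 3 * (F.L : ℝ) ^ (K - n) * μ j ≤ θ * (F.L : ℝ) ^ j)
    (hθ : 1000000000 * (F.L : ℝ) ^ 4 * θ ^ 2 ≤ 1)
    {s : ℝ} (hδW : ∀ b : PBond (F.P K) 0, ‖pertVar U₀ W b‖ ≤ s) (hs1 : s ≤ 1) :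
    ((1 / 4) * ((((F.L : ℝ) ^ (K - n))) ^ 2)⁻¹ - (18 + 537600 * (F.L : ℝ) ^ 4) * δ
        - (18 + 537600 * (F.L : ℝ) ^ 4) * (24576 * s ^ 2 + 768 * (ε * ((((F.L : ℝ) ^ (K - n))) ^ 2)⁻¹) ^ 2)) * (∑ b : PBond (F.P K) 0, ‖pertVar U₀ W b‖ ^ 2) - (18 + 537600 * (F.L : ℝ) ^ 4) * Z
      ≤ (18 + 537600 * (F.L : ℝ) ^ 4) * (4 * ∑ p : Plaq (F.P K) 0,
        ‖((GaugeField.plaqHol W p : Matrix.specialUnitaryGroup (Fin 2) ℂ) : Matrix (Fin 2) (Fin 2) ℂ)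
          * star ((GaugeField.plaqHol U₀ p : Matrix.specialUnitaryGroup (Fin 2) ℂ) : Matrix (Fin 2) (Fin 2) ℂ) - 1‖ ^ 2) := by
  have hcore := sum_normSq_le_curl_sq_core_of_fibre_noZQ_T3 F n K U₀ W hε hεL hU hfib Q hQ0 hQs G S Λ hG0 hS0 hΛ0 hΛs hGs hSs hdivB μ hμ0 hμ hμ72 hμN hθ0 hμθ hθ
  have hδ' : ∀ b : PBond (F.P K) 0, ‖(W b : Matrix (Fin 2) (Fin 2) ℂ) * star (U₀ b : Matrix (Fin 2) (Fin 2) ℂ) - 1‖ ≤ s := fun b => by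
    rw [← pertVar_eq]; exact hδW b
  have hc := sum_hs_curl_le_relPlaq_T3 F n K W U₀ hU hδ' hs1
  simp only [← pertVar_eq] at hc
  have hA0 : (0 : ℝ) ≤ (18 + 537600 * (F.L : ℝ) ^ 4) := by positivity
  have hc' := mul_le_mul_of_nonneg_left hc hA0
  linarith only [hcore, hc']

end Summit.QuantumFields.YangMills.Theorems.Prop7CurvedLandauCoreFibreMassT3

end
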